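import Summits.CriticalPhenomena.PercolationContinuityZ3.Theorems.PercNearOneGluingNoHeavyPcintMeanBondUnits
import Summits.CriticalPhenomena.PercolationContinuityZ3.Theorems.PercNearOneGluingNoHeavyPcintNawRandReduction
import HarnessLib

/-!
# PCINT lane, reduction B3m: averaging two-valued corner coins over the sibling orders

Cell `prim-pcint` (PAPER-2 track (iii): certified intervals for `p_c(ℤ^d)`), seat `prim-pcint-2` (gen 4); support file
(`--supports stmt-CriticalPhenomena-4575`).  Does NOT build on p205010.  Memo: `run/shared/lean/prim/pcint/REDUCTIONS.md` §B3m.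

Generalisation of `sum_orders_pow_card_badTimes` (`…NawRandReduction`): for a set `CS` of steps `s` whose two steps
`s, s+1` are perpendicular, and per-step values `x s` (bad coin) and `y s` (good coin), the coin indicators `IsBad o γ s` read
independent uniformly random permutations at distinct prefix nodes, so
`Σ_o ∏_{s ∈ CS} (x s ‖ y s) = #Orders · ∏_{s ∈ CS} (x s + y s)/2` (**`sum_orders_prod_coin2`**; the two-valued fair coin is
`sum_perm_coin`).  Used with `CS` = genuine corners (`s² ‖ 1`) ∪ corner-third steps (`t ‖ t'`) in `…MeanBondReduction`.
-/

noncomputable section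

namespace Summit.CriticalPhenomena.PercolationContinuityZ3.Theorems.Pcint

open Finset Literature.Probability.Percolation Literature.Probability.LatticeModels

variable {d n : ℕ}

/-- **The two-valued corner coin is fair**: `Σ_σ (x ‖ y) = #Perm · (x + y)/2` (`a ≠ b`, `f` injective). [folklore] -/
theorem sum_perm_coin {α : Type*} [Fintype α] [DecidableEq α] (x y : ℝ) (f : α → ℕ)
    (hf : Function.Injective f) {a b : α} (hab : a ≠ b) :
    ∑ σ : Equiv.Perm α, (if f (σ b) < f (σ a) then x else y) = Fintype.card (Equiv.Perm α) * ((x + y) / 2) := by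
  set g : Equiv.Perm α → ℝ := fun σ => if f (σ b) < f (σ a) then x else y with hg
  set ι : Equiv.Perm α → Equiv.Perm α := fun σ => σ.trans (Equiv.swap (σ a) (σ b)) with hι
  have hιa : ∀ σ, ι σ a = σ b := fun σ => by simp [hι, Equiv.swap_apply_left]
  have hιb : ∀ σ, ι σ b = σ a := fun σ => by simp [hι, Equiv.swap_apply_right]
  have hinv : Function.Involutive ι := by
    intro σ
    ext x
    rw [show ι (ι σ) x = Equiv.swap (ι σ a) (ι σ b) (ι σ x) from rfl, hιa, hιb,
      show ι σ x = Equiv.swap (σ a) (σ b) (σ x) from rfl, Equiv.swap_comm (σ b) (σ a),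
      Equiv.swap_apply_self]
  have hsum : ∑ σ, g (ι σ) = ∑ σ, g σ :=
    Fintype.sum_equiv (hinv.toPerm ι) (fun σ => g (ι σ)) g fun _ => rfl
  have hpair : ∀ σ, g σ + g (ι σ) = x + y := by
    intro σ
    have hne : f (σ a) ≠ f (σ b) := fun h => hab (σ.injective (hf h))
    simp only [hg, hιa, hιb]
    rcases lt_or_gt_of_ne hne with h | h
    · rw [if_neg (not_lt.2 h.le), if_pos h, add_comm]
    · rw [if_pos h, if_neg (not_lt.2 h.le)]
  have h2 : ∑ σ, g σ + ∑ σ, g (ι σ) = ∑ _σ : Equiv.Perm α, (x + y) := by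
    rw [← sum_add_distrib]
    exact sum_congr rfl fun σ _ => hpair σ
  rw [hsum, sum_const, card_univ, nsmul_eq_mul] at h2
  show ∑ σ, g σ = _
  linarith

/-- The two-valued coin factor of the step pair `s, s+1` under a permutation `σ` (junk `y s` for `s + 2 > n`). [folklore] -/
def coinFactor2 (x y : Fin n → ℝ) (γ : Fin n → Fin d × Bool) (s : Fin n) (σ : Equiv.Perm (Fin d × Bool)) : ℝ :=
  if h : (s : ℕ) + 2 ≤ n then
    (if dirCode (σ (γ ⟨s + 1, by omega⟩)) < dirCode (σ (γ ⟨s, by omega⟩)) then x s else y s)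
  else y s

/-- The coin factor read through `o` is `x s` on a bad coin and `y s` otherwise. [folklore] -/
theorem coinFactor2_eq_ite (x y : Fin n → ℝ) (o : Orders d n) (γ : Fin n → Fin d × Bool) (s : Fin n)
    [Decidable (IsBad o γ s)] :
    coinFactor2 x y γ s (o (pnode γ s)) = if IsBad o γ s then x s else y s := by
  obtain ⟨k, hk⟩ := s
  unfold coinFactor2 IsBad
  dsimp only
  by_cases h : k + 2 ≤ n
  · rw [dif_pos h]
    by_cases hlt : dirCode (o (pnode γ ⟨k, hk⟩) (γ ⟨k + 1, by omega⟩)) <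
        dirCode (o (pnode γ ⟨k, hk⟩) (γ ⟨k, hk⟩))
    · rw [if_pos hlt, if_pos ⟨h, hlt⟩]
    · rw [if_neg hlt, if_neg fun hh => hlt hh.2]
  · rw [dif_neg h, if_neg fun hh => h hh.1]

open Classical in
/-- **Averaging of two-valued corner coins.** For steps with perpendicular step pairs,
`Σ_o ∏_{s ∈ CS} (x s ‖ y s) = #Orders · ∏_{s ∈ CS} (x s + y s)/2`. [folklore] -/
theorem sum_orders_prod_coin2 (x y : Fin n → ℝ) (γ : Fin n → Fin d × Bool) (CS : Finset (Fin n))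
    (hperp : ∀ s ∈ CS, ChainBond.StepsPerp γ s) :
    ∑ o : Orders d n, ∏ s ∈ CS, (if IsBad o γ s then x s else y s) =
      Fintype.card (Orders d n) * ∏ s ∈ CS, ((x s + y s) / 2) := by
  set Φ : PNode d n → Equiv.Perm (Fin d × Bool) → ℝ :=
    fun u σ => ∏ s ∈ CS.filter (fun s => pnode γ s = u), coinFactor2 x y γ s σ with hΦ
  have h1 : ∀ o : Orders d n, ∏ s ∈ CS, (if IsBad o γ s then x s else y s) = ∏ u, Φ u (o u) := by
    intro o
    rw [← prod_fiberwise CS (pnode γ)]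
    refine prod_congr rfl fun u _ => prod_congr rfl fun s hs => ?_
    rw [← (mem_filter.1 hs).2, coinFactor2_eq_ite]
  have h2 : ∀ u, ∑ σ, Φ u σ = Fintype.card (Equiv.Perm (Fin d × Bool)) *
      ∏ s ∈ CS.filter (fun s => pnode γ s = u), ((x s + y s) / 2) := by
    intro u
    by_cases hu : u ∈ CS.image (pnode γ)
    · obtain ⟨s₀, hs₀, rfl⟩ := mem_image.1 hu
      have hfilter : CS.filter (fun s => pnode γ s = pnode γ s₀) = {s₀} := by
        ext s
        rw [mem_filter, mem_singleton]
        constructor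
        · rintro ⟨-, h⟩; exact pnode_injective γ h
        · rintro rfl; exact ⟨hs₀, rfl⟩
      simp only [hΦ, hfilter, prod_singleton]
      obtain ⟨h, hperp'⟩ := hperp s₀ hs₀
      have hab : γ ⟨s₀, by omega⟩ ≠ γ ⟨s₀ + 1, by omega⟩ := fun he => hperp' (congrArg Prod.fst he)
      simp only [coinFactor2, dif_pos h]
      exact sum_perm_coin (x s₀) (y s₀) dirCode dirCode_injective hab
    · have hfilter : CS.filter (fun s => pnode γ s = u) = ∅ := by
        rw [filter_eq_empty_iff]
        intro s hs he
        exact hu (mem_image.2 ⟨s, hs, he⟩)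
      simp only [hΦ, hfilter, prod_empty, sum_const, card_univ, nsmul_eq_mul, mul_one]
  simp_rw [h1]
  rw [← Fintype.prod_sum]
  simp_rw [h2]
  rw [prod_mul_distrib, prod_const, card_univ, prod_fiberwise CS (pnode γ) fun s => (x s + y s) / 2, Fintype.card_fun]
  push_cast
  ring

end Summit.CriticalPhenomena.PercolationContinuityZ3.Theorems.Pcint
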